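import Literature.Topology.FourManifolds.KnotsInBall
import Literature.Topology.FourManifolds.CircleFramingSplice
import HarnessLib

/-!
# Orientation signs of frames along the `3`-sphere and the stereographic chart

Topic `Literature/Topology/FourManifolds`; a brick of the decomposition of the Fox–Milnor
congruence `Literature.Topology.FourManifolds.Knot.IsConnectedSum.isConcordant`: to apply the
linearisation isotopy `exists_ambientIsotopy_comp_affine` (`LocalLinearisationIsotopy.lean`) to
the two end charts of a tube with one and the same affine map, one must know that the two
charts, read through the stereographic chart `ψ` of `𝕊³`, have Jacobians of the same sign.
The orientation bookkeeping uses the tree's frame determinant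
`CircleFraming.frameDet R T N = det (frame T N ∘ R)` (`CircleFramingSplice.lean`: `frame T N`
is `(a, w) ↦ a • T + N w`, the sign is relative to the fixed identification `R`). Everything
here is proved:

* `CircleFraming.frameDet_comp_right` — right multiplicativity
  `frameDet R T (N ∘ B) = frameDet R T N · det B` (companion of `frameDet_map`), and the sign
  lemma `CircleFraming.mul_pos_of_pos_iff`.
* `KnotsInBall.phi = (↑) ∘ ψ⁻¹ : ℝ³ → ℝ⁴` for `ψ = KnotsInBall.psi`, and a fixed
  `KnotsInBall.R₄ : ℝ⁴ ≃L ℝ × ℝ³`: `φ` is `C^∞` with unit norm, `Dφ` is injective (`ψ` is in the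
  atlas; `mfderiv_coe_sphere_injective`) and orthogonal to `φ`, so `(φ z, Dφ(z))` is a frame
  (`isFrame_phi`); **the chart has a constant orientation sign** (`frameDet_phi_pos_iff`, by
  `frameDet_pos_iff_of_isPreconnected` on the connected `ℝ³`), and the chain rule
  `frameDet (C x) (DC) = frameDet (φ (g x)) (Dφ) · det D(ψ ∘ C)` (`frameDet_eq_mul_det`).

## References

* M. W. Hirsch, *Differential Topology*, GTM 33 (1976), Ch. 4 §4 (orientations; the sign of the
  Jacobian in connected charts). [HirschDT1976]

## Design notes

No named facts, no `sorry`; `𝔼 n`, `𝕊 n` are local notation as in `Knots.lean`.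
-/

open scoped Manifold ContDiff Topology RealInnerProductSpace
open Function Set Metric

noncomputable section

namespace Literature.Topology.FourManifolds

/-! ### Right multiplicativity of the frame determinant -/

namespace CircleFraming

section Det

variable {E : Type*} [NormedAddCommGroup E] [NormedSpace ℝ E]
  {F : Type*} [NormedAddCommGroup F] [NormedSpace ℝ F] (R : E ≃L[ℝ] ℝ × F)

/-- Precomposing the columns: `frame T (N ∘ B) = frame T N ∘ (id × B)`. [folklore] -/
theorem frame_comp (T : E) (N : F →L[ℝ] E) (B : F →L[ℝ] F) :
    frame T (N.comp B) = (frame T N).comp ((ContinuousLinearMap.id ℝ ℝ).prodMap B) := by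
  ext q <;> simp [frame_apply]

variable [FiniteDimensional ℝ F]

/-- **Changing the columns of a frame by an endomorphism `B` of `F` multiplies the frame
determinant by `det B`**: `frameDet R T (N ∘ B) = frameDet R T N · det B` (conjugate `id × B` by
the identification `R` and use `det (id × B) = det B`). [folklore] -/
theorem frameDet_comp_right (T : E) (N : F →L[ℝ] E) (B : F →L[ℝ] F) :
    frameDet R T (N.comp B) = frameDet R T N * B.det := by
  unfold frameDet
  rw [frame_comp]
  -- `(frame ∘ (id × B)) ∘ R = (frame ∘ R) ∘ (R⁻¹ ∘ (id × B) ∘ R)`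
  have h : ((frame T N).comp ((ContinuousLinearMap.id ℝ ℝ).prodMap B)).comp (R : E →L[ℝ] ℝ × F) =
      ((frame T N).comp (R : E →L[ℝ] ℝ × F)).comp
        ((R.symm : ℝ × F →L[ℝ] E).comp (((ContinuousLinearMap.id ℝ ℝ).prodMap B).comp
          (R : E →L[ℝ] ℝ × F))) := by
    ext x; simp
  rw [h]
  change LinearMap.det ((((frame T N).comp (R : E →L[ℝ] ℝ × F) : E →L[ℝ] E) : E →ₗ[ℝ] E).comp
    (((R.symm : ℝ × F →L[ℝ] E).comp (((ContinuousLinearMap.id ℝ ℝ).prodMap B).comp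
      (R : E →L[ℝ] ℝ × F)) : E →L[ℝ] E) : E →ₗ[ℝ] E)) = _
  rw [LinearMap.det_comp]
  congr 1
  have hconj : (((R.symm : ℝ × F →L[ℝ] E).comp (((ContinuousLinearMap.id ℝ ℝ).prodMap B).comp
      (R : E →L[ℝ] ℝ × F)) : E →L[ℝ] E) : E →ₗ[ℝ] E) =
      ((R.symm : (ℝ × F) ≃L[ℝ] E).toLinearEquiv : ℝ × F →ₗ[ℝ] E).comp
        ((((ContinuousLinearMap.id ℝ ℝ).prodMap B : ℝ × F →L[ℝ] ℝ × F) : ℝ × F →ₗ[ℝ] ℝ × F).comp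
          ((R.symm : (ℝ × F) ≃L[ℝ] E).toLinearEquiv.symm : E →ₗ[ℝ] ℝ × F)) := by
    ext x; rfl
  rw [hconj, LinearMap.det_conj, ContinuousLinearMap.coe_prodMap, LinearMap.det_prodMap]
  simp [ContinuousLinearMap.det]

end Det

end CircleFraming

/-! ### The inverse stereographic chart as a map `ℝ³ → 𝕊³ ⊆ ℝ⁴` -/

/-- Local notation: `𝔼 n` is the model Euclidean space `EuclideanSpace ℝ (Fin n)`. -/
local notation "𝔼 " n:arg => EuclideanSpace ℝ (Fin n)

/-- Local notation: `𝕊 n` is the unit sphere in `EuclideanSpace ℝ (Fin (n + 1))`. -/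
local notation "𝕊 " n:arg => (Metric.sphere (0 : EuclideanSpace ℝ (Fin (n + 1))) 1)

attribute [local instance] fact_finrank_euclideanSpace_succ

namespace KnotsInBall

open CircleFraming

/-- A fixed identification `ℝ⁴ ≃ ℝ × ℝ³` for frame determinants of `3`-frames in `ℝ⁴` (only its
existence matters; signs of frame determinants are relative to it). [folklore] -/
def R₄ : (𝔼 4) ≃L[ℝ] ℝ × 𝔼 3 :=
  ContinuousLinearEquiv.ofFinrankEq (by simp)

/-- The inverse chart followed by the inclusion: `φ = (↑) ∘ ψ⁻¹ : ℝ³ → ℝ⁴`. [folklore] -/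
def phi (w : 𝔼 3) : 𝔼 4 := ((psi.symm w : 𝕊 3) : 𝔼 4)

/-- `φ` is `C^∞`. [folklore] -/
theorem contDiff_phi : ContDiff ℝ ∞ phi := by
  have h : ContMDiff (𝓡 3) 𝓘(ℝ, 𝔼 4) ∞ fun w : 𝔼 3 ↦ ((psi.symm w : 𝕊 3) : 𝔼 4) :=
    contMDiff_coe_sphere.comp contMDiff_psi_symm
  rw [contMDiff_iff_contDiff] at h
  exact h

/-- `φ` has unit norm. [folklore] -/
theorem norm_phi (w : 𝔼 3) : ‖phi w‖ = 1 := by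
  simp [phi]

/-- The derivative of `φ` is orthogonal to `φ`. [folklore] -/
theorem inner_phi_fderiv (w u : 𝔼 3) : ⟪phi w, fderiv ℝ phi w u⟫ = 0 := by
  have hd : DifferentiableAt ℝ phi w := (contDiff_phi.differentiable (by simp)) w
  have h1 : HasFDerivAt (fun w ↦ ‖phi w‖ ^ 2) (2 • (innerSL ℝ (phi w)).comp (fderiv ℝ phi w)) w :=
    hd.hasFDerivAt.norm_sq
  have h2 : HasFDerivAt (fun w ↦ ‖phi w‖ ^ 2) (0 : (𝔼 3) →L[ℝ] ℝ) w := by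
    have : (fun w ↦ ‖phi w‖ ^ 2) = fun _ ↦ (1 : ℝ) := by funext w; rw [norm_phi, one_pow]
    rw [this]; exact hasFDerivAt_const 1 w
  have := congrArg (fun L : (𝔼 3) →L[ℝ] ℝ ↦ L u) (h1.unique h2)
  simp [innerSL_apply_apply] at this
  exact this

/-- `ψ` belongs to the atlas of `𝕊³`. [folklore] -/
theorem psi_mem_atlas : psi ∈ atlas (𝔼 3) (𝕊 3) := ⟨southPole, rfl⟩

/-- **The derivative of `φ` is injective** (inverse of a chart, followed by the embedding of the
sphere). [folklore] -/
theorem injective_fderiv_phi (w : 𝔼 3) : Injective (fderiv ℝ phi w) := by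
  have hn : (∞ : WithTop ℕ∞) ≠ 0 := by simp
  have hmd : psi.MDifferentiable (𝓡 3) (𝓡 3) := mdifferentiable_of_mem_atlas psi_mem_atlas
  have hw : w ∈ psi.symm.source := by rw [psi.symm_source, psi_target]; exact mem_univ _
  have h1 : Injective (mfderiv (𝓡 3) (𝓡 3) psi.symm w) := hmd.symm.mfderiv_injective hw
  have h2 := mfderiv_coe_sphere_injective (n := 3) (psi.symm w)
  have hcomp : mfderiv 𝓘(ℝ, 𝔼 3) 𝓘(ℝ, 𝔼 4) phi w =
      (mfderiv (𝓡 3) 𝓘(ℝ, 𝔼 4) (Subtype.val : (𝕊 3) → 𝔼 4) (psi.symm w)).comp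
        (mfderiv (𝓡 3) (𝓡 3) psi.symm w) := by
    rw [show phi = Subtype.val ∘ psi.symm from rfl]
    exact mfderiv_comp w (contMDiff_coe_sphere.mdifferentiableAt hn)
      ((contMDiff_psi_symm w).mdifferentiableAt hn)
  rw [← mfderiv_eq_fderiv, hcomp]
  exact h2.comp h1

/-- **`(φ z, Dφ(z))` is a frame of `ℝ⁴`** for every `z`. [folklore] -/
theorem isFrame_phi (z : 𝔼 3) : IsFrame (phi z) (fderiv ℝ phi z) :=
  isFrame_of_inner_eq_zero (by simp) (injective_fderiv_phi z) (inner_phi_fderiv z)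
    (by rw [real_inner_self_eq_norm_sq, norm_phi]; norm_num)

/-- **The chart `ψ` has a constant orientation sign**: the frame determinants of
`(φ z, Dφ(z))` at any two points of `ℝ³` have the same sign
(`CircleFraming.frameDet_pos_iff_of_isPreconnected` on the connected `ℝ³`). [folklore] -/
theorem frameDet_phi_pos_iff (z₁ z₂ : 𝔼 3) :
    0 < CircleFraming.frameDet R₄ (phi z₁) (fderiv ℝ phi z₁) ↔ 0 < CircleFraming.frameDet R₄ (phi z₂) (fderiv ℝ phi z₂) :=
  frameDet_pos_iff_of_isPreconnected R₄ isPreconnected_univ contDiff_phi.continuous.continuousOn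
    (contDiff_phi.continuous_fderiv (by simp)).continuousOn (fun z _ ↦ isFrame_phi z)
    (mem_univ _) (mem_univ _)

/-- Two nonzero reals with the same sign have positive product. [folklore] -/
theorem _root_.Literature.Topology.FourManifolds.CircleFraming.mul_pos_of_pos_iff {a b : ℝ}
    (h : 0 < a ↔ 0 < b) (ha : a ≠ 0) (hb : b ≠ 0) : 0 < a * b := by
  rcases lt_or_gt_of_ne ha with ha | ha
  · have hb' : b < 0 := lt_of_le_of_ne (not_lt.1 fun hb' ↦ (lt_irrefl _ (ha.trans (h.2 hb')))) hb
    exact mul_pos_of_neg_of_neg ha hb'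
  · exact mul_pos ha (h.1 ha)

/-- The frame determinant of the chart never vanishes. [folklore] -/
theorem frameDet_phi_ne_zero (z : 𝔼 3) : CircleFraming.frameDet R₄ (phi z) (fderiv ℝ phi z) ≠ 0 :=
  (isFrame_iff_frameDet_ne_zero R₄).1 (isFrame_phi z)

/-- **Orientation through the chart (chain rule).** Let `C : ℝ³ → 𝕊³ ⊆ ℝ⁴` agree near `x` with
`φ ∘ g`, `g` differentiable at `x` (so `g = ψ ∘ C`): then
`frameDet (C x) (DC(x)) = frameDet (φ (g x)) (Dφ(g x)) · det Dg(x)`; in particular the sign of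
`det Dg(x)` is the orientation sign of the frame `(C, ∂C)` at `x` times the constant sign of the
chart. [folklore] -/
theorem frameDet_eq_mul_det {g : (𝔼 3) → 𝔼 3} {C : (𝔼 3) → 𝔼 4} {x : 𝔼 3}
    (hg : DifferentiableAt ℝ g x) (hC : phi ∘ g =ᶠ[𝓝 x] C) :
    CircleFraming.frameDet R₄ (C x) (fderiv ℝ C x) =
      CircleFraming.frameDet R₄ (phi (g x)) (fderiv ℝ phi (g x)) * (fderiv ℝ g x).det := by
  have h1 : fderiv ℝ C x = (fderiv ℝ phi (g x)).comp (fderiv ℝ g x) := by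
    rw [← hC.fderiv_eq]
    exact fderiv_comp x ((contDiff_phi.differentiable (by simp)) _) hg
  have h2 : C x = phi (g x) := (hC.self_of_nhds).symm
  rw [h1, h2, frameDet_comp_right]

end KnotsInBall

end Literature.Topology.FourManifolds
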